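import Summits.ValiantsHypothesis.ValiantsHypothesis.Theorems.BarrierLeverROABPSliceRank

/-!
# Route BarrierLever — the MODEL axis of crux `DefinableEquations` (stmt-ValiantsHypothesis-8745) /
# item `SingleSizeEquations` (8749): the `∃ a ∀ b` natural proof against READ-ONCE OBLIVIOUS ABPs —
# part 2/2: non-vanishing, constructivity, thresholds, and the headline

Continuation of `…ROABPSliceRank.lean` (`nisanCert n` = product over the balanced cuts `A` of the
determinants of Nisan's coefficient matrices of variables; it vanishes on every ROABP of width
`w < 2^{⌊n/2⌋}` in every variable order).  Here:
* NON-VANISHING: each factor is nonzero — at the cut's own witness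
  `cutWitness A = Σ_U x^{ρ_A U} x^{κ_A U} = ∏_j (1 + x_{ρ_A j} x_{κ_A j})` the evaluated matrix is
  the identity (`coeff_cutWitness`) — and `ℂ[c]` is a domain, so the product is a nonzero
  POLYNOMIAL (`nisanCert_ne_zero`); no single polynomial hard for all orders is needed.
* CONSTRUCTIVITY (`nisanCert_mem_distinguishers`, level 19: `≤ 2^n` factors, each a determinant of
  a `2^{⌊n/2⌋}`-square matrix of variables), the natural proof `isNaturalProof_nisanCert` for every
  width `w < 2^{⌊n/2⌋}`, the threshold `n^b < 2^{⌊n/2⌋}` for `n ≥ 2 · 4^{b+2}` (sibling file), and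
  the HEADLINES `naturalProofsAgainstROABP` (`∃ a = 19 ∀ b ∃ n₀ ∀ n ≥ n₀`, the crux's sentence with
  `SmallCircuits ℂ n b ↦ roabpSlice n (n^b)`), `roabpSliceEquations` (boolean-sum form, `q = 0`),
  `not_isSuccinctHittingSet_roabp_of_lt_two_pow` (every width `< 2^{⌊n/2⌋}` at the same level), and
  the explicit per-order lower bound `cutWitness_not_isROABP` (Nisan: `∏_j (1 + x_{ρ j} x_{κ j})`
  needs width `2^{⌊n/2⌋}` in any order reading all `ρ`-variables before all `κ`-variables).
WHAT THIS IS NOT: nothing on general circuits / ABPs (the crux, CT23 dir. 2), 8746, 14610 or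
VP vs VNP; classical (Nisan 1991) mathematics made FSV-natural and kernel-checked.
-/

-- layout Summits/ValiantsHypothesis/ValiantsHypothesis forces the duplicated namespace component
set_option linter.dupNamespace false

noncomputable section

open MvPolynomial Finsupp

namespace Summit.ValiantsHypothesis.ValiantsHypothesis.Theorems.BarrierLever.ROABPSlice

open Literature.Computability.AlgebraicComplexity Literature.Barriers.ValiantsHypothesis
open SigmaLambdaSigmaSlice (pow_mul_succ_lt_two_pow_half)

section slice

variable {n : ℕ}

/-! ## Non-vanishing: every factor is a nonzero polynomial -/

variable (n) in
/-- The witness of the cut `A`: `Σ_{U ⊆ Fin ⌊n/2⌋} x^{ρ_A U} x^{κ_A U} = ∏_j (1 + x_{ρ_A j} x_{κ_A j})`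
(degree `≤ n`). [cite: Nisan1991Noncommutative, Thm 1] -/
def cutWitness (A : Cut n) : MvPolynomial (Fin n) ℂ :=
  ∑ U : HSub n, monomial (sqfree (U.map (colEmb A)) + sqfree (U.map (rowEmb A))) 1

/-- Values of a mapped square-free exponent on the range of the embedding. [folklore] -/
theorem sqfree_map_apply (e : Fin (n / 2) ↪ Fin n) (U : HSub n) (j : Fin (n / 2)) :
    sqfree (U.map e) (e j) = if j ∈ U then 1 else 0 := by
  classical
  simp [sqfree_apply]

/-- The row exponent vanishes on the column variables. [folklore] -/
theorem sqfree_map_rowEmb_colEmb (A : Cut n) (U : HSub n) (j : Fin (n / 2)) :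
    sqfree (U.map (rowEmb A)) (colEmb A j) = 0 := by
  classical
  rw [sqfree_apply, if_neg]
  intro h
  obtain ⟨j', -, hj'⟩ := Finset.mem_map.mp h
  exact colEmb_not_mem A j (hj' ▸ rowEmb_mem A j')

/-- The column exponent vanishes on the row variables. [folklore] -/
theorem sqfree_map_colEmb_rowEmb (A : Cut n) (U : HSub n) (j : Fin (n / 2)) :
    sqfree (U.map (colEmb A)) (rowEmb A j) = 0 := by
  classical
  rw [sqfree_apply, if_neg]
  intro h
  obtain ⟨j', -, hj'⟩ := Finset.mem_map.mp h
  exact colEmb_not_mem A j' (hj'.symm ▸ rowEmb_mem A j)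

/-- `x^{κ U₁} x^{ρ U₁} = x^{κ U'} x^{ρ U}` forces `U₁ = U' = U`. [folklore] -/
theorem cutExp_eq_iff (A : Cut n) (U₁ U U' : HSub n) :
    sqfree (U₁.map (colEmb A)) + sqfree (U₁.map (rowEmb A)) =
        sqfree (U'.map (colEmb A)) + sqfree (U.map (rowEmb A)) ↔ U₁ = U' ∧ U₁ = U := by
  refine ⟨fun h => ?_, by rintro ⟨rfl, rfl⟩; rfl⟩
  constructor
  · ext j
    have hj := DFunLike.congr_fun h (colEmb A j)
    simp only [Finsupp.add_apply, sqfree_map_apply, sqfree_map_rowEmb_colEmb, add_zero] at hj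
    by_cases h1 : j ∈ U₁ <;> by_cases h2 : j ∈ U' <;> simp [h1, h2] at hj ⊢
  · ext j
    have hj := DFunLike.congr_fun h (rowEmb A j)
    simp only [Finsupp.add_apply, sqfree_map_apply, sqfree_map_colEmb_rowEmb, zero_add] at hj
    by_cases h1 : j ∈ U₁ <;> by_cases h2 : j ∈ U <;> simp [h1, h2] at hj ⊢

/-- The coefficients of the cut witness on the cut coordinates: the identity pattern. [folklore] -/
theorem coeff_cutWitness (A : Cut n) (U U' : HSub n) :
    coeff (sqfree (U'.map (colEmb A)) + sqfree (U.map (rowEmb A))) (cutWitness n A) =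
      if U = U' then 1 else 0 := by
  classical
  simp only [cutWitness, coeff_sum, coeff_monomial, cutExp_eq_iff]
  by_cases hUU : U = U'
  · subst hUU
    rw [if_pos rfl, Finset.sum_eq_single U]
    · rw [if_pos ⟨rfl, rfl⟩]
    · intro U₁ _ hU₁
      exact if_neg fun h => hU₁ h.2
    · simp
  · rw [if_neg hUU]
    exact Finset.sum_eq_zero fun U₁ _ => if_neg fun h => hUU (h.2.symm.trans h.1)

/-- At the cut witness, the evaluated cut matrix is the identity, so its determinant is `1`.
[cite: Nisan1991Noncommutative, Thm 1] -/
theorem det_cutMatrix_cutWitness (A : Cut n) :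
    (Matrix.of fun U U' => coeffVector (degLEMonomials n) (cutWitness n A) (cutCoord n A U U')).det
      = 1 := by
  classical
  have hM : (Matrix.of fun U U' =>
      coeffVector (degLEMonomials n) (cutWitness n A) (cutCoord n A U U')) = 1 := by
    ext U U'
    rw [Matrix.of_apply, coeffVector_apply, Matrix.one_apply]
    exact coeff_cutWitness A U U'
  rw [hM, Matrix.det_one]

/-- Each factor of the certificate is a nonzero polynomial. [folklore] -/
theorem det_cutMatrix_ne_zero (A : Cut n) : (cutMatrix n A).det ≠ 0 := by
  intro h
  have h1 := eval_det_cutMatrix (coeffVector (degLEMonomials n) (cutWitness n A)) A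
  rw [h, map_zero, det_cutMatrix_cutWitness] at h1
  exact zero_ne_one h1

/-- **The certificate is a nonzero polynomial** (a product of nonzero polynomials in a domain).
[folklore] -/
theorem nisanCert_ne_zero : nisanCert n ≠ 0 :=
  Finset.prod_ne_zero_iff.mpr fun A _ => det_cutMatrix_ne_zero A

/-- The cut witness has degree `≤ n`. [folklore] -/
theorem totalDegree_cutWitness_le (A : Cut n) : (cutWitness n A).totalDegree ≤ n := by
  classical
  refine (totalDegree_finsetSum _ _).trans (Finset.sup_le fun U _ => ?_)
  refine (totalDegree_monomial_le _ _).trans ?_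
  have h := degree_cutExp_le A U U
  simpa [Finsupp.sum, Finsupp.degree_apply] using h

/-- **An explicit Nisan lower bound**: the cut witness of `A_π` (degree `≤ n`) has no ROABP of width
`w < 2^{⌊n/2⌋}` in the order `π`. [cite: Nisan1991Noncommutative, Thm 1] -/
theorem cutWitness_not_isROABP {w d : ℕ} (π : Fin n ≃ Fin n) (hw : w < 2 ^ (n / 2)) :
    ¬ IsROABP ℂ w d π (cutWitness n (orderCut π)) := fun hf => by
  have h := det_cutMatrix_orderCut_eq_zero hf hw
  rw [det_cutMatrix_cutWitness] at h
  exact one_ne_zero h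

/-! ## Constructivity: a level-19 distinguisher -/

/-- `deg (nisanCert n) ≤ C(n,⌊n/2⌋) · 2^{⌊n/2⌋}`. [folklore] -/
theorem totalDegree_nisanCert_le :
    (nisanCert n).totalDegree ≤ n.choose (n / 2) * 2 ^ (n / 2) := by
  classical
  rw [nisanCert]
  refine (totalDegree_finsetProd _ _).trans ?_
  have hdet : ∀ A : Cut n, (cutMatrix n A).det.totalDegree ≤ 2 ^ (n / 2) := fun A => by
    refine (NaturalProofsAgainstAllLinearSizes.totalDegree_det_le_card _ fun U U' => ?_).trans
      (by rw [Fintype.card_finset, Fintype.card_fin])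
    rw [cutMatrix, Matrix.of_apply, totalDegree_X]
  calc ∑ A : Cut n, (cutMatrix n A).det.totalDegree ≤ ∑ _A : Cut n, 2 ^ (n / 2) :=
        Finset.sum_le_sum fun A _ => hdet A
    _ = n.choose (n / 2) * 2 ^ (n / 2) := by
        rw [Finset.sum_const, Finset.card_univ, Fintype.card_finset_len, Fintype.card_fin,
          smul_eq_mul]

/-- `L(nisanCert n) ≤ C(n,⌊n/2⌋) · 8 (2^{⌊n/2⌋} + 1)⁷ + C(n,⌊n/2⌋)`. [folklore] -/
theorem complexity_nisanCert_le :
    complexity (nisanCert n) ≤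
      n.choose (n / 2) * (8 * (2 ^ (n / 2) + 1) ^ 7 + (2 ^ (n / 2)) ^ 2 * 0) + n.choose (n / 2) := by
  classical
  rw [nisanCert]
  refine (complexity_finset_prod_le _ _).trans ?_
  have hdet : ∀ A : Cut n, complexity (cutMatrix n A).det ≤
      8 * (2 ^ (n / 2) + 1) ^ 7 + (2 ^ (n / 2)) ^ 2 * 0 := fun A => by
    have h := NaturalProofsAgainstAllLinearSizes.complexity_det_le (cutMatrix n A) 0 fun U U' => by
      rw [cutMatrix, Matrix.of_apply, complexity_X_holds]
    rwa [Fintype.card_finset, Fintype.card_fin] at h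
  calc ∑ A : Cut n, complexity (cutMatrix n A).det + (Finset.univ : Finset (Cut n)).card
      ≤ ∑ _A : Cut n, (8 * (2 ^ (n / 2) + 1) ^ 7 + (2 ^ (n / 2)) ^ 2 * 0) +
          (Finset.univ : Finset (Cut n)).card := by
        gcongr with A _
        exact hdet A
    _ = _ := by
        rw [Finset.sum_const, Finset.card_univ, Fintype.card_finset_len, Fintype.card_fin,
          smul_eq_mul]

/-- **Constructivity**: `nisanCert n ∈ Distinguishers ℂ n 19` for `n ≥ 1`. [folklore] -/
theorem nisanCert_mem_distinguishers (hn : 1 ≤ n) : nisanCert n ∈ Distinguishers ℂ n 19 := by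
  set N := (2 * n).choose n with hNdef
  have h2N : 2 ^ n ≤ N := Literature.ModelTheory.FiniteModelTheory.two_pow_le_choose_two_mul_self n
  have hC : n.choose (n / 2) ≤ N := (Nat.choose_le_two_pow n (n / 2)).trans h2N
  have hK : 2 ^ (n / 2) ≤ N :=
    (Nat.pow_le_pow_right (by norm_num) (Nat.div_le_self n 2)).trans h2N
  have hN2 : 2 ≤ N := le_trans (by
    calc (2 : ℕ) = 2 ^ 1 := by norm_num
      _ ≤ 2 ^ n := Nat.pow_le_pow_right (by norm_num) hn) h2N
  have h1024 : 1024 ≤ N ^ 10 := by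
    calc (1024 : ℕ) = 2 ^ 10 := by norm_num
      _ ≤ N ^ 10 := Nat.pow_le_pow_left hN2 10
  refine ⟨complexity_nisanCert_le.trans ?_, totalDegree_nisanCert_le.trans ?_⟩
  · calc n.choose (n / 2) * (8 * (2 ^ (n / 2) + 1) ^ 7 + (2 ^ (n / 2)) ^ 2 * 0) + n.choose (n / 2)
        ≤ N * (8 * (2 * N) ^ 7 + 0) + N := by
          have : 2 ^ (n / 2) + 1 ≤ 2 * N := by omega
          refine Nat.add_le_add (Nat.mul_le_mul hC (Nat.add_le_add
            (Nat.mul_le_mul_left 8 (Nat.pow_le_pow_left this 7)) (by rw [mul_zero]))) hC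
      _ = 1024 * N ^ 8 + N := by ring
      _ ≤ N ^ 10 * N ^ 8 + N ^ 18 := Nat.add_le_add (Nat.mul_le_mul_right _ h1024)
          (by calc N = N ^ 1 := (pow_one N).symm
                 _ ≤ N ^ 18 := Nat.pow_le_pow_right (by omega) (by norm_num))
      _ = 2 * N ^ 18 := by ring
      _ ≤ N * N ^ 18 := Nat.mul_le_mul_right _ hN2
      _ = N ^ 19 := by ring
  · calc n.choose (n / 2) * 2 ^ (n / 2) ≤ N * N := Nat.mul_le_mul hC hK
      _ = N ^ 2 := by ring
      _ ≤ N ^ 19 := Nat.pow_le_pow_right (by omega) (by norm_num)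

/-! ## The natural proof: one level, every width below `2^{⌊n/2⌋}`, every order -/

/-- **Natural proof against ROABPs** of width `w < 2^{⌊n/2⌋}` in any variable order (`n ≥ 1`), at
level 19. [cite: ForbesShpilkaVolk2018, Def. 1] -/
theorem isNaturalProof_nisanCert {w : ℕ} (hn : 1 ≤ n) (hw : w < 2 ^ (n / 2)) :
    IsNaturalProof (degLEMonomials n) (roabpSlice n w) (Distinguishers ℂ n 19) (nisanCert n) :=
  ⟨nisanCert_mem_distinguishers hn, nisanCert_ne_zero, fun _ hf => eval_nisanCert_eq_zero_of_mem hw hf⟩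

/-- **Exponential width at one level**: for `n ≥ 1` and every `w < 2^{⌊n/2⌋}`, the degree-`≤ n`
polynomials with a width-`w` ROABP in some order are not a succinct hitting set for
`Distinguishers ℂ n 19`. [cite: Nisan1991Noncommutative, Thm 1] -/
theorem not_isSuccinctHittingSet_roabp_of_lt_two_pow (hn : 1 ≤ n) {w : ℕ} (hw : w < 2 ^ (n / 2)) :
    ¬ IsSuccinctHittingSet (degLEMonomials n) (roabpSlice n w) (Distinguishers ℂ n 19) :=
  (exists_isNaturalProof_iff _ _ _).mp ⟨_, isNaturalProof_nisanCert hn hw⟩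

/-- The threshold: `n^b < 2^{⌊n/2⌋}` for `n ≥ 2 · 4^{b+2}`. [folklore] -/
theorem pow_lt_two_pow_half {b n : ℕ} (hn : 2 * 4 ^ (b + 2) ≤ n) : n ^ b < 2 ^ (n / 2) :=
  lt_of_le_of_lt (Nat.le_mul_of_pos_right _ (Nat.succ_pos n)) (pow_mul_succ_lt_two_pow_half hn)

end slice

/-- **HEADLINE — the crux's quantifier shape `∃ a ∀ b` on the ROABP slice.**  There is ONE level
`a` (`= 19`) such that for EVERY width exponent `b`, for all `n ≥ 2 · 4^{b+2}`, the polynomials of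
degree `≤ n` in `n` variables computed by a read-once oblivious ABP of width `n^b` (individual
degree `≤ n`) in SOME variable order are NOT a succinct hitting set for `Distinguishers ℂ n a`:
`DefinableEquations` (item 8745) holds verbatim with `SmallCircuits ℂ n b` replaced by
`roabpSlice n (n ^ b)`, with `q = 0` boolean variables. [cite: Nisan1991Noncommutative, Thm 1] -/
theorem naturalProofsAgainstROABP : ∃ a : ℕ, ∀ b : ℕ, ∃ n₀ : ℕ, ∀ n ≥ n₀,
    ¬ IsSuccinctHittingSet (degLEMonomials n) (roabpSlice n (n ^ b)) (Distinguishers ℂ n a) := by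
  refine ⟨19, fun b => ⟨2 * 4 ^ (b + 2), fun n hn => ?_⟩⟩
  have hn1 : 1 ≤ n := le_trans (by have := Nat.one_le_pow (b + 2) 4 (by norm_num); omega) hn
  exact not_isSuccinctHittingSet_roabp_of_lt_two_pow hn1 (pow_lt_two_pow_half hn)

/-- **The 8745-shaped statement on the ROABP slice** (boolean-sum form): ONE level `a = 19` such
that for every `b` and all `n ≥ 2 · 4^{b+2}` a nonzero level-`a` boolean sum in the coefficient
variables (here with `q = 0` boolean variables) vanishes at `coeff f` for every
`f ∈ roabpSlice n (n^b)`. [cite: Nisan1991Noncommutative, Thm 1] -/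
theorem roabpSliceEquations : ∃ a : ℕ, ∀ b : ℕ, ∃ n₀ : ℕ, ∀ n ≥ n₀,
    ∃ q : ℕ, q ≤ (Nat.choose (2 * n) n) ^ a ∧
      ∃ H : MvPolynomial (↥(degLEMonomials n) ⊕ Fin q) ℂ,
        complexity H ≤ (Nat.choose (2 * n) n) ^ a ∧ H.totalDegree ≤ (Nat.choose (2 * n) n) ^ a ∧
        boolSum H ≠ 0 ∧
        ∀ f ∈ roabpSlice n (n ^ b), eval (coeffVector (degLEMonomials n) f) (boolSum H) = 0 := by
  refine ⟨19, fun b => ⟨2 * 4 ^ (b + 2), fun n hn =>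
    ⟨0, Nat.zero_le _, MvPolynomial.rename Sum.inl (nisanCert n), ?_⟩⟩⟩
  have hn1 : 1 ≤ n := le_trans (by have := Nat.one_le_pow (b + 2) 4 (by norm_num); omega) hn
  obtain ⟨hD, hne, hvan⟩ := isNaturalProof_nisanCert hn1 (pow_lt_two_pow_half hn)
  obtain ⟨hc, hdeg, hsum⟩ := SingleSizeEquations.distinguisher_isBoolSum hD
  refine ⟨hc, hdeg, by rwa [hsum], fun f hf => ?_⟩
  rw [hsum]
  exact hvan f hf

end Summit.ValiantsHypothesis.ValiantsHypothesis.Theorems.BarrierLever.ROABPSlice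

end
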